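import Literature.Topology.FourManifolds.Cobordism
import Literature.Topology.FourManifolds.DiffeotopyPartialTransport
import HarnessLib

/-!
# Product regions of a cobordism: diffeomorphisms supported over a product region extend

Topic `Literature/Topology/FourManifolds`; written for the fact seat of
`Literature.Barriers.SmoothPoincare4.akbulutRuberman2016_symmetryKillingCobordism` (S. Akbulut,
D. Ruberman, *Absolutely exotic compact 4-manifolds*, Comment. Math. Helv. 91 (2016), §3,
proof of Thm. A, Claim: "every element [of `π₀ Diff(N)`] extends over the cobordism `X` in such
a way that it is isotopic to the identity on `M`" — "Any such generator extends in a natural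
way"). The generators there are Dehn twists supported in a collar `T × [0, 1]` of a torus of
`N`, over which the cobordism `X = M × I - (L × D² × I) ∪ ∐ᵢ (S³ × I - Cᵢ × D²)` of Lemma 2.3 is
the product `(T × [0, 1]) × I`; the "natural" extension is the twist at every level of `I`. This
file isolates the four-dimensional (indeed `(n + 1)`-dimensional) half of that step:

* `Literature.Topology.FourManifolds.Cobordism.ProductRegion X` — **a product region of a
  cobordism** `X = (W; M, N)`: an open set `U ⊆ M` (the source of a partial diffeomorphism
  `top : M ⊇ U ⇀ N` onto an open subset of the far end) and a map `toFun : M → ℝ → W`, `C^∞` on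
  `U × [0, 1]`, with `toFun x 0 = inl x`, `toFun x 1 = inr (top x)` (`x ∈ U`), a bijection of
  `U × [0, 1]` onto an open set `region ⊆ W` with `C^∞` inverse `(proj, height)` there — the
  fields of the tree's long open collars (`Cobordism.InlOpenCollar`, `CobordismBoundaryData.lean`)
  for a two-ended collar;
* `Literature.Topology.FourManifolds.exists_diffeomorph_partialTransport` — the static form of
  `Diffeotopy.exists_partialTransport` (`DiffeotopyPartialTransport.lean`): a self-diffeomorphism
  supported in a compact subset of the target of a partial diffeomorphism `ψ : M ⇀ N` is
  transported to a self-diffeomorphism `ψ⁻¹ ∘ k ∘ ψ ∪ id` of `M` (Hirsch (1976), Ch. 8 §1);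
* `Literature.Topology.FourManifolds.Cobordism.ProductRegion.exists_extension` — **a
  diffeomorphism of `M` supported in a compact subset of `U` extends over `X` on the nose**:
  for `k : M ≅ M` with `k = id` off a compact `K ⊆ U` there are self-diffeomorphisms `G` of `W`
  and `g` of `N` with `G ∘ inl = inl ∘ k`, `G ∘ inr = inr ∘ g`, where `g = top ∘ k ∘ top⁻¹ ∪ id`
  is the transport of `k` to the far end and `G = toFun ∘ (k × id) ∘ (proj, height) ∪ id` is
  `k` at every level of the product region.

With `M`, `N` interchanged by `Cobordism.symm` nothing changes; in the application the far-end
diffeomorphism `g` is the generator (a Dehn twist along a torus of `N`) and the near-end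
diffeomorphism `k` is the shell twist of a solid torus of `M`, isotopic to the identity
(`SolidTorusShellTwist.lean`). Everything here is proved; no named facts are introduced.

## References

* S. Akbulut, D. Ruberman, Comment. Math. Helv. 91 (2016), §3, proof of the Claim.
  [AkbulutRuberman2016]
* M. W. Hirsch, *Differential Topology*, GTM 33 (1976), Ch. 8 §1, Thms. 1.3–1.4. [HirschDT1976]
* J. Milnor, *Lectures on the h-cobordism theorem* (1965), §1 (collars of the ends of a
  cobordism). [MilnorHCobordism1965]
-/

open scoped Manifold ContDiff Topology
open Set Function

noncomputable section

namespace Literature.Topology.FourManifolds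

universe u

/-- Local notation: `𝔼 n` is the model Euclidean space `EuclideanSpace ℝ (Fin n)`. -/
local notation "𝔼 " n:arg => EuclideanSpace ℝ (Fin n)

/-! ### Static transport of a compactly supported diffeomorphism along a partial diffeomorphism -/

section StaticTransport

variable {EM HM EN HN : Type*} [NormedAddCommGroup EM] [NormedSpace ℝ EM] [TopologicalSpace HM]
  [NormedAddCommGroup EN] [NormedSpace ℝ EN] [TopologicalSpace HN]
  {J : ModelWithCorners ℝ EM HM} {J' : ModelWithCorners ℝ EN HN}
  {M : Type*} [TopologicalSpace M] [ChartedSpace HM M]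
  {N : Type*} [TopologicalSpace N] [ChartedSpace HN N]

/-- A bijection which is the identity off `K` preserves membership in every superset of `K`.
[folklore] -/
theorem mem_iff_mem_of_eq_self_off {α : Type*} {f : α → α} (hf : Injective f) {K S : Set α}
    (h : ∀ y, y ∉ K → f y = y) (hKS : K ⊆ S) (x : α) : f x ∈ S ↔ x ∈ S := by
  by_cases hx : x ∈ K
  · exact ⟨fun _ => hKS hx, fun _ => hKS (Diffeotopy.mapsTo_of_eq_self_off hf h hx)⟩
  · rw [h x hx]

/-- **Static transport of a compactly supported diffeomorphism along a partial diffeomorphism.**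
Let `ψ : M ⇀ N` be an open partial homeomorphism, `C^∞` on its source with `C^∞` inverse on its
target (`M` Hausdorff), and `k` a self-diffeomorphism of `N` which is the identity off a compact
subset `K` of the target of `ψ`. Then there is a self-diffeomorphism `k'` of `M` with
`k' x = ψ⁻¹ (k (ψ x))` on the source and `k' x = x` off the source (the static companion of
`Diffeotopy.exists_partialTransport`). [cite: HirschDT1976, Ch. 8 §1, Thm. 1.3] -/
theorem exists_diffeomorph_partialTransport [T2Space M] (ψ : OpenPartialHomeomorph M N)
    (hψ : ContMDiffOn J J' ∞ ψ ψ.source) (hψ' : ContMDiffOn J' J ∞ ψ.symm ψ.target)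
    (k : N ≃ₘ⟮J', J'⟯ N) {K : Set N} (hK : IsCompact K) (hKψ : K ⊆ ψ.target)
    (hk : ∀ y, y ∉ K → k y = y) :
    ∃ k' : M ≃ₘ⟮J, J⟯ M, (∀ x ∈ ψ.source, k' x = ψ.symm (k (ψ x))) ∧
      ∀ x, x ∉ ψ.source → k' x = x := by
  classical
  have hk' : ∀ y, y ∉ K → k.symm y = y := fun y hy => by
    conv_lhs => rw [← hk y hy]
    exact k.symm_apply_apply y
  -- the maps `k`, `k⁻¹` preserve the target of `ψ`
  have hpres : ∀ (f : N → N), Injective f → (∀ y, y ∉ K → f y = y) →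
      ∀ y ∈ ψ.target, f y ∈ ψ.target := fun f hfi hfs y hy =>
    (mem_iff_mem_of_eq_self_off hfi hfs hKψ y).2 hy
  have hpk := hpres k k.injective hk
  have hpk' := hpres k.symm k.symm.injective hk'
  -- the compact `ψ⁻¹(K)` is closed and lies in the source
  set C : Set M := ψ.symm '' K with hC
  have hCc : IsClosed C :=
    (hK.image_of_continuousOn (ψ.continuousOn_symm.mono hKψ)).isClosed
  have hCsrc : C ⊆ ψ.source := by
    rintro _ ⟨y, hy, rfl⟩
    exact ψ.map_target (hKψ hy)
  -- the transported maps
  set F : (N → N) → M → M := fun f x => if x ∈ ψ.source then ψ.symm (f (ψ x)) else x with hF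
  have hF_of_mem : ∀ (f : N → N) {x}, x ∈ ψ.source → F f x = ψ.symm (f (ψ x)) :=
    fun f x hx => by simp only [hF, if_pos hx]
  have hF_of_not_mem : ∀ (f : N → N) {x}, x ∉ ψ.source → F f x = x :=
    fun f x hx => by simp only [hF, if_neg hx]
  have hF_mem : ∀ (f : N → N), (∀ y ∈ ψ.target, f y ∈ ψ.target) →
      ∀ {x}, x ∈ ψ.source → F f x ∈ ψ.source := fun f hf x hx => by
    rw [hF_of_mem f hx]
    exact ψ.map_target (hf _ (ψ.map_source hx))
  have hF_of_not_mem_C : ∀ (f : N → N), (∀ y, y ∉ K → f y = y) →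
      ∀ {x}, x ∉ C → F f x = x := by
    intro f hfs x hxC
    by_cases hx : x ∈ ψ.source
    · have hψx : ψ x ∉ K := fun h => hxC ⟨ψ x, h, ψ.left_inv hx⟩
      rw [hF_of_mem f hx, hfs _ hψx, ψ.left_inv hx]
    · exact hF_of_not_mem f hx
  -- inverse relations
  have hinv : ∀ (f f' : N → N), (∀ y ∈ ψ.target, f y ∈ ψ.target) → (∀ y, f' (f y) = y) →
      ∀ x, F f' (F f x) = x := by
    intro f f' hf hff' x
    by_cases hx : x ∈ ψ.source
    · rw [hF_of_mem f' (hF_mem f hf hx), hF_of_mem f hx,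
        ψ.right_inv (hf _ (ψ.map_source hx)), hff', ψ.left_inv hx]
    · rw [hF_of_not_mem f hx, hF_of_not_mem f' hx]
  -- smoothness
  have key : ∀ (f : N → N), ContMDiff J' J' ∞ f → (∀ y, y ∉ K → f y = y) →
      (∀ y ∈ ψ.target, f y ∈ ψ.target) → ContMDiff J J ∞ (F f) := by
    intro f hf hfs hft x
    by_cases hxs : x ∈ ψ.source
    · have hev : F f =ᶠ[𝓝 x] fun x' => ψ.symm (f (ψ x')) := by
        filter_upwards [ψ.open_source.mem_nhds hxs] with x' hx'
        exact hF_of_mem f hx'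
      refine ContMDiffAt.congr_of_eventuallyEq ?_ hev
      have h1 : ContMDiffAt J J' ∞ ψ x := hψ.contMDiffAt (ψ.open_source.mem_nhds hxs)
      have h2 : ContMDiffAt J' J' ∞ f (ψ x) := hf.contMDiffAt
      have h3 : ContMDiffAt J' J ∞ ψ.symm (f (ψ x)) :=
        hψ'.contMDiffAt (ψ.open_target.mem_nhds (hft _ (ψ.map_source hxs)))
      exact h3.comp x (h2.comp x h1)
    · have hxC : x ∉ C := fun h => hxs (hCsrc h)
      have hev : F f =ᶠ[𝓝 x] id := by
        filter_upwards [hCc.isOpen_compl.mem_nhds hxC] with x' hx'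
        exact hF_of_not_mem_C f hfs hx'
      exact contMDiffAt_id.congr_of_eventuallyEq hev
  let k' : M ≃ₘ⟮J, J⟯ M :=
    { toFun := F k
      invFun := F k.symm
      left_inv := hinv k k.symm hpk k.symm_apply_apply
      right_inv := hinv k.symm k hpk' k.apply_symm_apply
      contMDiff_toFun := key k k.contMDiff hk hpk
      contMDiff_invFun := key k.symm k.symm.contMDiff hk' hpk' }
  exact ⟨k', fun x hx => hF_of_mem k hx, fun x hx => hF_of_not_mem k hx⟩

end StaticTransport

/-! ### Product regions -/

section ProductRegion

variable {n : ℕ} {M N : Type u} [TopologicalSpace M] [ChartedSpace (𝔼 n) M]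
  [TopologicalSpace N] [ChartedSpace (𝔼 n) N]

/-- **A product region of a cobordism** `X = (W; M, N)` (`dim W = n + 1`) over the open set
`U = top.source ⊆ M`: a partial diffeomorphism `top : M ⊇ U ⇀ N` onto an open subset of the far
end (`C^∞` with `C^∞` inverse) and a map `toFun : M → ℝ → W`, `C^∞` on `U × [0, 1]` (product
model `(𝓡 n) × 𝓘(ℝ, ℝ)`, target model `𝓡∂ (n + 1)`), which is `inl` at height `0` and
`inr ∘ top` at height `1` on `U`, and maps `U × [0, 1]` bijectively onto the open set `region`
with `C^∞` inverse `z ↦ (proj z, height z)` there. Informally: `W ⊇ region ≅ U × [0, 1]` with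
`U × {0} = inl(U)`, `U × {1} = inr(top U)` — over `U` the cobordism is a product. (In
Akbulut–Ruberman's `X = M × I - (L × D² × I) ∪ …`, `U` is a toral shell around a component of
`L`.) The fields are those of `Cobordism.InlOpenCollar` for a two-ended collar. [cite: AkbulutRuberman2016, §3, proof of the Claim] [cite: MilnorHCobordism1965, §1] -/
structure Cobordism.ProductRegion (X : Cobordism n M N) where
  /-- The identification of the base `U ⊆ M` with an open subset of the far end `N`. -/
  top : OpenPartialHomeomorph M N
  /-- `top` is `C^∞` on its source. -/
  contMDiffOn_top : ContMDiffOn (𝓡 n) (𝓡 n) ∞ top top.source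
  /-- `top⁻¹` is `C^∞` on its target. -/
  contMDiffOn_top_symm : ContMDiffOn (𝓡 n) (𝓡 n) ∞ top.symm top.target
  /-- The product parametrisation `U × [0, 1] → W` (only these values matter). -/
  toFun : M → ℝ → X.W
  /-- The `M`-component of the inverse. -/
  proj : X.W → M
  /-- The height component of the inverse. -/
  height : X.W → ℝ
  /-- The image of `U × [0, 1]`. -/
  region : Set X.W
  /-- `region` is open. -/
  isOpen_region : IsOpen region
  /-- At height `0` the parametrisation is the near end `inl`. -/
  apply_zero : ∀ x ∈ top.source, toFun x 0 = X.inl x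
  /-- At height `1` the parametrisation is the far end `inr ∘ top`. -/
  apply_one : ∀ x ∈ top.source, toFun x 1 = X.inr (top x)
  /-- The parametrisation maps `U × [0, 1]` into `region`. -/
  mem_region : ∀ x ∈ top.source, ∀ t ∈ Icc (0 : ℝ) 1, toFun x t ∈ region
  /-- `proj` inverts the first component. -/
  proj_apply : ∀ x ∈ top.source, ∀ t ∈ Icc (0 : ℝ) 1, proj (toFun x t) = x
  /-- `height` inverts the second component. -/
  height_apply : ∀ x ∈ top.source, ∀ t ∈ Icc (0 : ℝ) 1, height (toFun x t) = t
  /-- `proj` maps `region` into `U`. -/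
  proj_mem : ∀ z ∈ region, proj z ∈ top.source
  /-- The height of a point of `region` lies in `[0, 1]`. -/
  height_mem : ∀ z ∈ region, height z ∈ Icc (0 : ℝ) 1
  /-- `toFun ∘ (proj, height) = id` on `region`. -/
  apply_proj_height : ∀ z ∈ region, toFun (proj z) (height z) = z
  /-- The parametrisation is `C^∞` on `U × [0, 1]`. -/
  contMDiffOn_toFun : ContMDiffOn ((𝓡 n).prod 𝓘(ℝ, ℝ)) (𝓡∂ (n + 1)) ∞ (uncurry toFun)
    (top.source ×ˢ Icc (0 : ℝ) 1)
  /-- `proj` is `C^∞` on `region`. -/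
  contMDiffOn_proj : ContMDiffOn (𝓡∂ (n + 1)) (𝓡 n) ∞ proj region
  /-- `height` is `C^∞` on `region`. -/
  contMDiffOn_height : ContMDiffOn (𝓡∂ (n + 1)) 𝓘(ℝ, ℝ) ∞ height region

namespace Cobordism.ProductRegion

variable {X : Cobordism n M N} (R : X.ProductRegion)

/-- The inverse `(proj, height) : W → M × ℝ` (meaningful on `region`). [folklore] -/
def projHeight (z : X.W) : M × ℝ := (R.proj z, R.height z)

/-- Formula for `projHeight` (definitional). [folklore] -/
@[simp] theorem projHeight_apply (z : X.W) : R.projHeight z = (R.proj z, R.height z) := rfl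

/-- `projHeight` is smooth on `region`. [folklore] -/
theorem contMDiffOn_projHeight :
    ContMDiffOn (𝓡∂ (n + 1)) ((𝓡 n).prod 𝓘(ℝ, ℝ)) ∞ R.projHeight R.region :=
  R.contMDiffOn_proj.prodMk R.contMDiffOn_height

/-- `projHeight (toFun x t) = (x, t)` on `U × [0, 1]`. [folklore] -/
theorem projHeight_apply_toFun {x : M} (hx : x ∈ R.top.source) {t : ℝ} (ht : t ∈ Icc (0 : ℝ) 1) :
    R.projHeight (R.toFun x t) = (x, t) :=
  Prod.ext (R.proj_apply x hx t ht) (R.height_apply x hx t ht)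

/-- `projHeight` maps `region` into `U × [0, 1]`. [folklore] -/
theorem projHeight_mem {z : X.W} (hz : z ∈ R.region) :
    R.projHeight z ∈ R.top.source ×ˢ Icc (0 : ℝ) 1 :=
  ⟨R.proj_mem z hz, R.height_mem z hz⟩

/-- `toFun` inverts `projHeight` on `region`. [folklore] -/
theorem uncurry_toFun_projHeight {z : X.W} (hz : z ∈ R.region) :
    uncurry R.toFun (R.projHeight z) = z :=
  R.apply_proj_height z hz

/-- `inl x ∈ region` for `x ∈ U`. [folklore] -/
theorem inl_mem_region {x : M} (hx : x ∈ R.top.source) : X.inl x ∈ R.region := by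
  rw [← R.apply_zero x hx]
  exact R.mem_region x hx 0 ⟨le_rfl, zero_le_one⟩

/-- `inr (top x) ∈ region` for `x ∈ U`. [folklore] -/
theorem inr_top_mem_region {x : M} (hx : x ∈ R.top.source) : X.inr (R.top x) ∈ R.region := by
  rw [← R.apply_one x hx]
  exact R.mem_region x hx 1 ⟨zero_le_one, le_rfl⟩

/-- The parametrisation is `C^∞` at every point of `U × (0, 1)`. [folklore] -/
theorem contMDiffAt_uncurry_toFun {x : M} (hx : x ∈ R.top.source) {t : ℝ} (ht : t ∈ Ioo (0 : ℝ) 1) :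
    ContMDiffAt ((𝓡 n).prod 𝓘(ℝ, ℝ)) (𝓡∂ (n + 1)) ∞ (uncurry R.toFun) (x, t) :=
  R.contMDiffOn_toFun.contMDiffAt
    (Filter.mem_of_superset ((R.top.open_source.prod isOpen_Ioo).mem_nhds ⟨hx, ht⟩)
      (prod_mono Subset.rfl Ioo_subset_Icc_self))

/-- **Points of height strictly between `0` and `1` are interior points of `W`**: there the
parametrisation has the smooth right inverse `projHeight` on the open set `region`, so its
differential is onto, and `M × ℝ` has no boundary
(`MDifferentiableAt.isInteriorPoint_of_surjective_mfderiv`). [folklore] -/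
theorem isInteriorPoint_apply [IsManifold (𝓡 n) ∞ M] {x : M} (hx : x ∈ R.top.source) {t : ℝ}
    (ht : t ∈ Ioo (0 : ℝ) 1) : (𝓡∂ (n + 1)).IsInteriorPoint (R.toFun x t) := by
  have ht' : t ∈ Icc (0 : ℝ) 1 := Ioo_subset_Icc_self ht
  have hz : R.toFun x t ∈ R.region := R.mem_region x hx t ht'
  have hf : MDifferentiableAt ((𝓡 n).prod 𝓘(ℝ, ℝ)) (𝓡∂ (n + 1)) (uncurry R.toFun) (x, t) :=
    (R.contMDiffAt_uncurry_toFun hx ht).mdifferentiableAt (by simp)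
  have hg : MDifferentiableAt (𝓡∂ (n + 1)) ((𝓡 n).prod 𝓘(ℝ, ℝ)) R.projHeight (R.toFun x t) :=
    ((R.contMDiffOn_projHeight.contMDiffAt (R.isOpen_region.mem_nhds hz)).mdifferentiableAt
      (by simp))
  have hcomp : mfderiv (𝓡∂ (n + 1)) (𝓡∂ (n + 1)) (uncurry R.toFun ∘ R.projHeight) (R.toFun x t) =
      (mfderiv ((𝓡 n).prod 𝓘(ℝ, ℝ)) (𝓡∂ (n + 1)) (uncurry R.toFun) (x, t)).comp
        (mfderiv (𝓡∂ (n + 1)) ((𝓡 n).prod 𝓘(ℝ, ℝ)) R.projHeight (R.toFun x t)) := by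
    have h := mfderiv_comp (R.toFun x t) (R.projHeight_apply_toFun hx ht' ▸ hf) hg
    rw [h, R.projHeight_apply_toFun hx ht']
  have hid : mfderiv (𝓡∂ (n + 1)) (𝓡∂ (n + 1)) (uncurry R.toFun ∘ R.projHeight) (R.toFun x t) =
      ContinuousLinearMap.id ℝ _ := by
    have hev : uncurry R.toFun ∘ R.projHeight =ᶠ[𝓝 (R.toFun x t)] id :=
      Filter.eventuallyEq_of_mem (R.isOpen_region.mem_nhds hz) fun z hz =>
        R.uncurry_toFun_projHeight hz
    rw [hev.mfderiv_eq, mfderiv_id]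
  have hsurj : Surjective
      (mfderiv ((𝓡 n).prod 𝓘(ℝ, ℝ)) (𝓡∂ (n + 1)) (uncurry R.toFun) (x, t)) := by
    intro v
    refine ⟨mfderiv (𝓡∂ (n + 1)) ((𝓡 n).prod 𝓘(ℝ, ℝ)) R.projHeight (R.toFun x t) v, ?_⟩
    have := congrArg (fun L : TangentSpace (𝓡∂ (n + 1)) (R.toFun x t) →L[ℝ]
        TangentSpace (𝓡∂ (n + 1)) (R.toFun x t) => L v) (hcomp.symm.trans hid)
    exact this
  exact hf.isInteriorPoint_of_surjective_mfderiv hsurj BoundarylessManifold.isInteriorPoint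

/-- A point of `region` of height strictly between `0` and `1` is an interior point of `W`.
[folklore] -/
theorem isInteriorPoint_of_height_mem_Ioo [IsManifold (𝓡 n) ∞ M] {z : X.W} (hz : z ∈ R.region)
    (h : R.height z ∈ Ioo (0 : ℝ) 1) : (𝓡∂ (n + 1)).IsInteriorPoint z := by
  rw [← R.apply_proj_height z hz]
  exact R.isInteriorPoint_apply (R.proj_mem z hz) h

/-- A point of `region` of height strictly between `0` and `1` is not a boundary point of `W`.
[folklore] -/
theorem not_mem_boundary_of_height_mem_Ioo [IsManifold (𝓡 n) ∞ M] {z : X.W} (hz : z ∈ R.region)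
    (h : R.height z ∈ Ioo (0 : ℝ) 1) : z ∉ (𝓡∂ (n + 1)).boundary X.W := fun hb =>
  ((𝓡∂ (n + 1)).isInteriorPoint_iff_not_isBoundaryPoint z).1
    (R.isInteriorPoint_of_height_mem_Ioo hz h) hb

/-- A point of `region` of height `0` is `inl (proj z)`. [folklore] -/
theorem eq_inl_proj {z : X.W} (hz : z ∈ R.region) (h0 : R.height z = 0) :
    z = X.inl (R.proj z) := by
  rw [← R.apply_zero _ (R.proj_mem z hz), ← h0, R.apply_proj_height z hz]

/-- A point of `region` of height `1` is `inr (top (proj z))`. [folklore] -/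
theorem eq_inr_top_proj {z : X.W} (hz : z ∈ R.region) (h1 : R.height z = 1) :
    z = X.inr (R.top (R.proj z)) := by
  rw [← R.apply_one _ (R.proj_mem z hz), ← h1, R.apply_proj_height z hz]

/-- Trichotomy of the height of a point of `region`. [folklore] -/
theorem height_trichotomy {z : X.W} (hz : z ∈ R.region) :
    R.height z = 0 ∨ R.height z ∈ Ioo (0 : ℝ) 1 ∨ R.height z = 1 := by
  obtain ⟨h0, h1⟩ := R.height_mem z hz
  rcases h0.eq_or_lt with h | h
  · exact Or.inl h.symm
  rcases h1.eq_or_lt with h' | h'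
  · exact Or.inr (Or.inr h')
  · exact Or.inr (Or.inl ⟨h, h'⟩)

/-- **The region meets the near end exactly at height `0`**: a point of `region` lies on
`inl(M)` iff its height is `0`. (At height `1` it lies on `inr(N)`, which is disjoint from
`inl(M)`; in between it is an interior point, whereas the ends lie on `∂W`.) [folklore] -/
theorem mem_range_inl_iff [IsManifold (𝓡 n) ∞ M] {z : X.W} (hz : z ∈ R.region) :
    z ∈ range X.inl ↔ R.height z = 0 := by
  refine ⟨fun hzl => ?_, fun h0 => ⟨R.proj z, (R.eq_inl_proj hz h0).symm⟩⟩
  rcases R.height_trichotomy hz with h | h | h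
  · exact h
  · obtain ⟨x, rfl⟩ := hzl
    exact (R.not_mem_boundary_of_height_mem_Ioo hz h (X.inl_mem_boundary x)).elim
  · have h1 : z ∈ range X.inr := ⟨R.top (R.proj z), (R.eq_inr_top_proj hz h).symm⟩
    exact (Set.disjoint_left.1 X.disjoint_range hzl h1).elim

/-- **The region meets the far end exactly at height `1`.** [folklore] -/
theorem mem_range_inr_iff [IsManifold (𝓡 n) ∞ M] {z : X.W} (hz : z ∈ R.region) :
    z ∈ range X.inr ↔ R.height z = 1 := by
  refine ⟨fun hzr => ?_, fun h1 => ⟨R.top (R.proj z), (R.eq_inr_top_proj hz h1).symm⟩⟩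
  rcases R.height_trichotomy hz with h | h | h
  · have h0 : z ∈ range X.inl := ⟨R.proj z, (R.eq_inl_proj hz h).symm⟩
    exact (Set.disjoint_left.1 X.disjoint_range h0 hzr).elim
  · obtain ⟨y, rfl⟩ := hzr
    exact (R.not_mem_boundary_of_height_mem_Ioo hz h (X.inr_mem_boundary y)).elim
  · exact h

/-- `proj (inl x) = x` for `x ∈ U`. [folklore] -/
theorem proj_inl {x : M} (hx : x ∈ R.top.source) : R.proj (X.inl x) = x := by
  rw [← R.apply_zero x hx, R.proj_apply x hx 0 ⟨le_rfl, zero_le_one⟩]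

/-- `height (inl x) = 0` for `x ∈ U`. [folklore] -/
theorem height_inl {x : M} (hx : x ∈ R.top.source) : R.height (X.inl x) = 0 := by
  rw [← R.apply_zero x hx, R.height_apply x hx 0 ⟨le_rfl, zero_le_one⟩]

/-- `proj (inr (top x)) = x` for `x ∈ U`. [folklore] -/
theorem proj_inr_top {x : M} (hx : x ∈ R.top.source) : R.proj (X.inr (R.top x)) = x := by
  rw [← R.apply_one x hx, R.proj_apply x hx 1 ⟨zero_le_one, le_rfl⟩]

/-- `height (inr (top x)) = 1` for `x ∈ U`. [folklore] -/
theorem height_inr_top {x : M} (hx : x ∈ R.top.source) : R.height (X.inr (R.top x)) = 1 := by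
  rw [← R.apply_one x hx, R.height_apply x hx 1 ⟨zero_le_one, le_rfl⟩]

/-- **The near end meets the region exactly in `inl(U)`.** [folklore] -/
theorem inl_mem_region_iff [IsManifold (𝓡 n) ∞ M] (x : M) :
    X.inl x ∈ R.region ↔ x ∈ R.top.source := by
  refine ⟨fun hz => ?_, fun hx => R.inl_mem_region hx⟩
  have h0 : R.height (X.inl x) = 0 := (R.mem_range_inl_iff hz).1 (mem_range_self x)
  have h := R.eq_inl_proj hz h0
  rw [X.isSmoothEmbedding_inl.isEmbedding.injective h]
  exact R.proj_mem _ hz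

/-- **The far end meets the region exactly in `inr(top U)`.** [folklore] -/
theorem inr_mem_region_iff [IsManifold (𝓡 n) ∞ M] (y : N) :
    X.inr y ∈ R.region ↔ y ∈ R.top.target := by
  refine ⟨fun hz => ?_, fun hy => ?_⟩
  · have h1 : R.height (X.inr y) = 1 := (R.mem_range_inr_iff hz).1 (mem_range_self y)
    have h := R.eq_inr_top_proj hz h1
    rw [X.isSmoothEmbedding_inr.isEmbedding.injective h]
    exact R.top.map_source (R.proj_mem _ hz)
  · rw [← R.top.right_inv hy]
    exact R.inr_top_mem_region (R.top.map_target hy)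

/-! ### Extension of diffeomorphisms supported over the product region -/

/-- **The level-preserving extension** of a self-map `f` of `M` over the product region:
`toFun (f (proj z)) (height z)` on `region`, the identity elsewhere. [folklore] -/
def levelMap (f : M → M) (z : X.W) : X.W := by
  classical
  exact if z ∈ R.region then R.toFun (f (R.proj z)) (R.height z) else z

/-- Formula on `region`. [folklore] -/
theorem levelMap_of_mem (f : M → M) {z : X.W} (hz : z ∈ R.region) :
    R.levelMap f z = R.toFun (f (R.proj z)) (R.height z) := by
  classical
  simp only [levelMap, if_pos hz]

/-- Formula off `region`. [folklore] -/
theorem levelMap_of_not_mem (f : M → M) {z : X.W} (hz : z ∉ R.region) : R.levelMap f z = z := by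
  classical
  simp only [levelMap, if_neg hz]

/-- On the parametrised points the level map is `f` at every level. [folklore] -/
theorem levelMap_apply_toFun (f : M → M) {x : M} (hx : x ∈ R.top.source) {t : ℝ}
    (ht : t ∈ Icc (0 : ℝ) 1) :
    R.levelMap f (R.toFun x t) = R.toFun (f x) t := by
  rw [R.levelMap_of_mem f (R.mem_region x hx t ht), R.proj_apply x hx t ht,
    R.height_apply x hx t ht]

section LevelMap

variable {f : M → M} (hfU : ∀ x ∈ R.top.source, f x ∈ R.top.source)
include hfU

/-- The level map preserves `region`. [folklore] -/
theorem levelMap_mem {z : X.W} (hz : z ∈ R.region) : R.levelMap f z ∈ R.region := by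
  rw [R.levelMap_of_mem f hz]
  exact R.mem_region _ (hfU _ (R.proj_mem z hz)) _ (R.height_mem z hz)

/-- `proj` of the level map. [folklore] -/
theorem proj_levelMap {z : X.W} (hz : z ∈ R.region) : R.proj (R.levelMap f z) = f (R.proj z) := by
  rw [R.levelMap_of_mem f hz]
  exact R.proj_apply _ (hfU _ (R.proj_mem z hz)) _ (R.height_mem z hz)

/-- `height` of the level map. [folklore] -/
theorem height_levelMap {z : X.W} (hz : z ∈ R.region) :
    R.height (R.levelMap f z) = R.height z := by
  rw [R.levelMap_of_mem f hz]
  exact R.height_apply _ (hfU _ (R.proj_mem z hz)) _ (R.height_mem z hz)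

/-- The level map of a left inverse is a left inverse. [folklore] -/
theorem levelMap_levelMap {f' : M → M} (hff' : ∀ x, f' (f x) = x) (z : X.W) :
    R.levelMap f' (R.levelMap f z) = z := by
  by_cases hz : z ∈ R.region
  · rw [R.levelMap_of_mem f' (R.levelMap_mem hfU hz), R.proj_levelMap hfU hz,
      R.height_levelMap hfU hz, hff', R.apply_proj_height z hz]
  · rw [R.levelMap_of_not_mem f hz, R.levelMap_of_not_mem f' hz]

/-- **Smoothness of the level map** for `f` smooth and equal to the identity off a compact
`K ⊆ U`: near `region` it is the composite `toFun ∘ (f × id) ∘ (proj, height)` of smooth maps,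
near the closed complement of the compact `toFun (K × [0, 1])` it is the identity. [folklore] -/
theorem contMDiff_levelMap (hf : ContMDiff (𝓡 n) (𝓡 n) ∞ f) {K : Set M} (hK : IsCompact K)
    (hKU : K ⊆ R.top.source) (hfK : ∀ x, x ∉ K → f x = x) :
    ContMDiff (𝓡∂ (n + 1)) (𝓡∂ (n + 1)) ∞ (R.levelMap f) := by
  -- the compact image of `K × [0, 1]` is closed and lies in `region`
  set C : Set X.W := uncurry R.toFun '' (K ×ˢ Icc (0 : ℝ) 1) with hC
  have hCc : IsClosed C :=
    ((hK.prod isCompact_Icc).image_of_continuousOn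
      (R.contMDiffOn_toFun.continuousOn.mono (prod_mono hKU Subset.rfl))).isClosed
  have hCr : C ⊆ R.region := by
    rintro _ ⟨⟨x, t⟩, ⟨hx, ht⟩, rfl⟩
    exact R.mem_region x (hKU hx) t ht
  have hid : ∀ z, z ∉ C → R.levelMap f z = z := by
    intro z hzC
    by_cases hz : z ∈ R.region
    · have hpK : R.proj z ∉ K := fun h =>
        hzC ⟨(R.proj z, R.height z), ⟨h, R.height_mem z hz⟩, R.apply_proj_height z hz⟩
      rw [R.levelMap_of_mem f hz, hfK _ hpK, R.apply_proj_height z hz]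
    · exact R.levelMap_of_not_mem f hz
  -- the composite on `region`
  have hcomp : ContMDiffOn (𝓡∂ (n + 1)) (𝓡∂ (n + 1)) ∞
      (uncurry R.toFun ∘ fun z => (f (R.proj z), R.height z)) R.region := by
    refine R.contMDiffOn_toFun.comp ?_ fun z hz => ⟨hfU _ (R.proj_mem z hz), R.height_mem z hz⟩
    exact (hf.comp_contMDiffOn R.contMDiffOn_proj).prodMk R.contMDiffOn_height
  intro z
  by_cases hz : z ∈ R.region
  · have hev : R.levelMap f =ᶠ[𝓝 z] (uncurry R.toFun ∘ fun z => (f (R.proj z), R.height z)) := by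
      filter_upwards [R.isOpen_region.mem_nhds hz] with z' hz'
      exact R.levelMap_of_mem f hz'
    exact (hcomp.contMDiffAt (R.isOpen_region.mem_nhds hz)).congr_of_eventuallyEq hev
  · have hzC : z ∉ C := fun h => hz (hCr h)
    have hev : R.levelMap f =ᶠ[𝓝 z] id := by
      filter_upwards [hCc.isOpen_compl.mem_nhds hzC] with z' hz'
      exact hid z' hz'
    exact contMDiffAt_id.congr_of_eventuallyEq hev

end LevelMap

/-- **The level-preserving extension of a diffeomorphism supported over the product region**,
as a self-diffeomorphism of `W` (inverse: the level map of `k⁻¹`). [folklore] -/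
def levelDiffeo [IsManifold (𝓡 n) ∞ M] (k : M ≃ₘ⟮𝓡 n, 𝓡 n⟯ M) {K : Set M} (hK : IsCompact K)
    (hKU : K ⊆ R.top.source) (hk : ∀ x, x ∉ K → k x = x) :
    X.W ≃ₘ⟮𝓡∂ (n + 1), 𝓡∂ (n + 1)⟯ X.W :=
  have hk' : ∀ x, x ∉ K → k.symm x = x := fun x hx => by
    conv_lhs => rw [← hk x hx]
    exact k.symm_apply_apply x
  have hkU : ∀ x ∈ R.top.source, k x ∈ R.top.source := fun x hx =>
    (mem_iff_mem_of_eq_self_off k.injective hk hKU x).2 hx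
  have hkU' : ∀ x ∈ R.top.source, k.symm x ∈ R.top.source := fun x hx =>
    (mem_iff_mem_of_eq_self_off k.symm.injective hk' hKU x).2 hx
  { toFun := R.levelMap k
    invFun := R.levelMap k.symm
    left_inv := R.levelMap_levelMap hkU k.symm_apply_apply
    right_inv := R.levelMap_levelMap hkU' k.apply_symm_apply
    contMDiff_toFun := R.contMDiff_levelMap hkU k.contMDiff hK hKU hk
    contMDiff_invFun := R.contMDiff_levelMap hkU' k.symm.contMDiff hK hKU hk' }

/-- The level diffeomorphism is, as a function, the level map (definitional). [folklore] -/
@[simp]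
theorem coe_levelDiffeo [IsManifold (𝓡 n) ∞ M] (k : M ≃ₘ⟮𝓡 n, 𝓡 n⟯ M) {K : Set M}
    (hK : IsCompact K) (hKU : K ⊆ R.top.source) (hk : ∀ x, x ∉ K → k x = x) :
    ⇑(R.levelDiffeo k hK hKU hk) = R.levelMap k := rfl

/-- **A diffeomorphism of `M` supported over a product region extends over the cobordism on the
nose** (Akbulut–Ruberman: "Any such generator extends in a natural way over" `X`). Let `R` be a
product region of `X = (W; M, N)` over `U ⊆ M` and `k` a self-diffeomorphism of `M` which is the
identity off a compact subset `K ⊆ U`. Then there are self-diffeomorphisms `G` of `W` and `g` of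
`N` with `G ∘ inl = inl ∘ k` and `G ∘ inr = inr ∘ g`; here `g = top ∘ k ∘ top⁻¹` on `top(U)` and
the identity elsewhere (the transport of `k` to the far end along the product region), and `G`
is `k` at every level of the region and the identity off it.
[cite: AkbulutRuberman2016, §3, proof of the Claim] [cite: HirschDT1976, Ch. 8 §1, Thm. 1.3] -/
theorem exists_extension [IsManifold (𝓡 n) ∞ M] (k : M ≃ₘ⟮𝓡 n, 𝓡 n⟯ M) {K : Set M}
    (hK : IsCompact K) (hKU : K ⊆ R.top.source) (hk : ∀ x, x ∉ K → k x = x) :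
    ∃ (G : X.W ≃ₘ⟮𝓡∂ (n + 1), 𝓡∂ (n + 1)⟯ X.W) (g : N ≃ₘ⟮𝓡 n, 𝓡 n⟯ N),
      (∀ x, G (X.inl x) = X.inl (k x)) ∧ (∀ y, G (X.inr y) = X.inr (g y)) ∧
      (∀ x ∈ R.top.source, g (R.top x) = R.top (k x)) ∧ (∀ y, y ∉ R.top.target → g y = y) ∧
      (∀ x ∈ R.top.source, ∀ t ∈ Icc (0 : ℝ) 1, G (R.toFun x t) = R.toFun (k x) t) ∧
      (∀ z, z ∉ R.region → G z = z) := by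
  haveI : T2Space N := X.isSmoothEmbedding_inr.isEmbedding.t2Space
  have hkU : ∀ x ∈ R.top.source, k x ∈ R.top.source := fun x hx =>
    (mem_iff_mem_of_eq_self_off k.injective hk hKU x).2 hx
  -- the far-end transport `g = top ∘ k ∘ top⁻¹ ∪ id` (`K ⊆ U = top.symm.target`)
  obtain ⟨g, hg, hg'⟩ := exists_diffeomorph_partialTransport (J := 𝓡 n) (J' := 𝓡 n) R.top.symm
    R.contMDiffOn_top_symm (by simpa using R.contMDiffOn_top) k hK hKU hk
  refine ⟨R.levelDiffeo k hK hKU hk, g, fun x => ?_, fun y => ?_, fun x hx => ?_, hg',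
    fun x hx t ht => ?_, fun z hz => ?_⟩
  · -- near end
    by_cases hx : x ∈ R.top.source
    · rw [coe_levelDiffeo, R.levelMap_of_mem k (R.inl_mem_region hx), R.proj_inl hx,
        R.height_inl hx, R.apply_zero _ (hkU x hx)]
    · rw [coe_levelDiffeo, R.levelMap_of_not_mem k (mt (R.inl_mem_region_iff x).1 hx),
        hk x fun h => hx (hKU h)]
  · -- far end
    by_cases hy : y ∈ R.top.target
    · have hx : R.top.symm y ∈ R.top.source := R.top.map_target hy
      conv_lhs => rw [← R.top.right_inv hy]
      rw [coe_levelDiffeo, R.levelMap_of_mem k (R.inr_top_mem_region hx), R.proj_inr_top hx,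
        R.height_inr_top hx, R.apply_one _ (hkU _ hx), hg y hy]
      rfl
    · rw [coe_levelDiffeo, R.levelMap_of_not_mem k (mt (R.inr_mem_region_iff y).1 hy), hg' y hy]
  · -- formula for `g`
    have hy : R.top x ∈ R.top.symm.source := R.top.map_source hx
    rw [hg _ hy]
    change R.top (k (R.top.symm (R.top x))) = R.top (k x)
    rw [R.top.left_inv hx]
  · exact R.levelMap_apply_toFun k hx ht
  · exact R.levelMap_of_not_mem k hz

end Cobordism.ProductRegion

end ProductRegion

end Literature.Topology.FourManifolds

end
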